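import Mathlib.Data.Real.Basic
import Mathlib.Tactic.Linarith
import Mathlib.Tactic.Ring
import Mathlib.Tactic.Positivity
import Mathlib.Tactic.FieldSimp
import HarnessLib
import HarnessLib.Audit

/-!
# `NoHeavyLowerTail` (crux stmt-CriticalPhenomena-4575), Sahi programme P4 (Holley / monotone coupling):
# the maj-slot certificate on the pattern `2³` — I: the real inequalities (pair families `(↑i,↑i)`, `(↑i,↑j)` in the four regimes)

Support file (cell `prim-l12`, seat P4, generation 8; `--supports stmt-CriticalPhenomena-4575`).  No named facts, no sorries; standard axioms;
pure real algebra (FILE 1 of the blueprint in HOME prim-l12-p4/FROM-prim-l12-p4-gen8-PATTERN-CERTIFICATES.md §5b).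

Pattern `2³` with the majority slot `U' = {12, 13, 23, ⊤}`, `D' = {∅, 1, 2, 3}`.  For a FIXED labelling `(i, j, k)` of the atoms the eight (normalised) fibre
masses are `nE` (= `n_∅`), `ni, nj, nk`, `nij, nik, njk`, `nT`; `d = nE+ni+nj+nk`, `u = nij+nik+njk+nT` (`d + u = 1`), `N₂ = nij+nik+njk`,
`B_i = nij+nik+nT = n_U(↑i)`, `a_i = ni + B_i = n(↑i)`, `A_ij = nij + nT = n(↑ij)`, `σ_k = nik + njk`, `m_k = nE+ni+nj = d − nk`.
The hypotheses of each theorem are exactly the consequences of log-supermodularity of the pattern measure that the hand proof uses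
(FKG products `a_ia_j ≤ A_ij`, point conditions `nij·nik ≤ ni·nT`, `nik·njk ≤ nk·nT`, `nk·nij ≤ nE·nT`, the Ahlswede–Daykin trace fact `u·nk ≤ d·B_k`)
plus the regime inequalities; the conclusions are the PAIR inequalities `LHS ≥ need` of `…SahiE3PatternCertificate` for the essential trace pairs `(↑i,↑i)`,
`(↑i,↑j)`, `(↑i,↑k)`, `(↑k,↑k)` (memo §4b), with `need(↑i,↑j) = B_iB_j + d·a_ia_j − ninj`, `need(↑i,↑i) = B_i² + d·a_i² − ni²`, and `LHS` the certificate mass on the trace.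
Regimes: (A) `r_⊤ = (1+d)nT`, `r_xy = (1 − d·nT/N₂)n_xy`; (A'k) `r_⊤ = (1+d)nT`, `r_ij = u(1+nk) − (1+d)B_k`, `r_ik = (1+d)nik − u·nk·nik/σ_k`, `r_jk` likewise;
(B1) `r_⊤ = u`, rank 2 empty; (B2k) `r_ik = r_jk = 0`, `r_ij = u(1+nk) − (1+d)B_k`, `r_⊤ = (1+d)B_k − u·nk`.  Every statement below was checked numerically on
20,000 FKG pattern measures (HOME code/gen8/pat/maj_proofcheck.py, 0 failures) before being proved here.
-/

namespace Summit.CriticalPhenomena.PercolationContinuityZ3.Theorems.SahiE3MajAlgebra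

variable {nE ni nj nk nij nik njk nT : ℝ}

/-! ### Regime A (top full, uniform rank-2 fill) -/

/-- **Regime A, pair `(↑i,↑i)`** (an identity plus positivity; no FKG needed): with `r_ij + r_ik + r_⊤ = B_i + d·nT·njk/N₂`,
`r_ij + r_ik + r_⊤ + ni² ≥ B_i² + d·a_i²`. [this work] -/
theorem regA_pair_ii (hE : 0 ≤ nE) (hi : 0 ≤ ni) (hj : 0 ≤ nj) (hk : 0 ≤ nk) (hij : 0 ≤ nij) (hik : 0 ≤ nik) (hjk : 0 ≤ njk)
    (hT : 0 ≤ nT) (hN : 0 < nij + nik + njk) (hsum : nE + ni + nj + nk + nij + nik + njk + nT = 1) :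
    (nij + nik + nT) ^ 2 + (nE + ni + nj + nk) * (ni + (nij + nik + nT)) ^ 2 ≤
      (nij + nik + nT) + (nE + ni + nj + nk) * nT * njk / (nij + nik + njk) + ni ^ 2 := by
  have hfrac : 0 ≤ (nE + ni + nj + nk) * nT * njk / (nij + nik + njk) := by positivity
  have hE' : nE = 1 - ni - nj - nk - nij - nik - njk - nT := by linarith
  -- identity (uses `d + u = 1`): `B + ni² − B² − d(ni+B)² = (1+d)·B·njk + m_i²·B + ni²·njk`
  have key : (nij + nik + nT) + ni ^ 2 - ((nij + nik + nT) ^ 2 + (nE + ni + nj + nk) * (ni + (nij + nik + nT)) ^ 2) =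
      (1 + (nE + ni + nj + nk)) * (nij + nik + nT) * njk + (nE + nj + nk) ^ 2 * (nij + nik + nT) + ni ^ 2 * njk := by
    rw [hE']; ring
  have p1 : 0 ≤ (1 + (nE + ni + nj + nk)) * (nij + nik + nT) * njk := by positivity
  have p2 : 0 ≤ (nE + nj + nk) ^ 2 * (nij + nik + nT) := by positivity
  have p3 : 0 ≤ ni ^ 2 * njk := by positivity
  linarith [key, p1, p2, p3, hfrac]

/-- **Regime A, pair `(↑i,↑j)`**: with `L_ij = r_ij + r_⊤ = A_ij + d·nT·σ_k/N₂`, `L_ij + ninj ≥ B_iB_j + d·a_ia_j`.  Uses FKG `a_ia_j ≤ A_ij` and the two point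
conditions `nij·nik ≤ ni·nT`, `nik·njk ≤ nk·nT`. [this work] -/
theorem regA_pair_ij (hE : 0 ≤ nE) (hi : 0 ≤ ni) (hj : 0 ≤ nj) (hk : 0 ≤ nk) (hij : 0 ≤ nij) (hik : 0 ≤ nik) (hjk : 0 ≤ njk)
    (hT : 0 ≤ nT) (hN : 0 < nij + nik + njk) (hsum : nE + ni + nj + nk + nij + nik + njk + nT = 1)
    (hfkg : (ni + (nij + nik + nT)) * (nj + (nij + njk + nT)) ≤ nij + nT)
    (hl1 : nij * nik ≤ ni * nT) (hl2 : nik * njk ≤ nk * nT) :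
    (nij + nik + nT) * (nij + njk + nT) + (nE + ni + nj + nk) * ((ni + (nij + nik + nT)) * (nj + (nij + njk + nT))) ≤
      (nij + nT) + (nE + ni + nj + nk) * nT * (nik + njk) / (nij + nik + njk) + ni * nj := by
  set d := nE + ni + nj + nk with hd
  set N := nij + nik + njk with hNdef
  have hd0 : 0 ≤ d := by positivity
  -- step 1: FKG
  have s1 : d * ((ni + (nij + nik + nT)) * (nj + (nij + njk + nT))) ≤ d * (nij + nT) := mul_le_mul_of_nonneg_left hfkg hd0
  -- step 2: it remains to show `B_iB_j ≤ (nij+nT)(1−d) + d nT σ/N + ni nj`, and `(1−d) = u = A_ij + σ`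
  have hu : 1 - d = (nij + nT) + (nik + njk) := by rw [hd]; linarith
  -- the chain `nik njk N ≤ d nT σ`
  have chain : nik * njk * N ≤ d * nT * (nik + njk) := by
    have e : nik * njk * N = (nij * nik) * njk + nik * njk * (nik + njk) := by rw [hNdef]; ring
    rw [e]
    have t1 : (nij * nik) * njk ≤ (ni * nT) * njk := mul_le_mul_of_nonneg_right hl1 hjk
    have t2 : nik * njk * (nik + njk) ≤ nk * nT * (nik + njk) := mul_le_mul_of_nonneg_right hl2 (by linarith)
    have t3 : (ni * nT) * njk ≤ ni * nT * (nik + njk) := by nlinarith [mul_nonneg hi hT]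
    have t4 : (ni + nk) * nT * (nik + njk) ≤ d * nT * (nik + njk) := by
      have : ni + nk ≤ d := by rw [hd]; linarith
      exact mul_le_mul_of_nonneg_right (mul_le_mul_of_nonneg_right this hT) (by linarith)
    nlinarith [t1, t2, t3, t4]
  have hfracge : nik * njk ≤ d * nT * (nik + njk) / N := by
    rw [le_div_iff₀ hN]; exact chain
  -- assemble: B_iB_j = A_ij² + A_ij σ + nik njk and (1−d)A_ij = A_ij² + A_ij σ
  have eBB : (nij + nik + nT) * (nij + njk + nT) = (nij + nT) ^ 2 + (nij + nT) * (nik + njk) + nik * njk := by ring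
  nlinarith [s1, hfracge, eBB, hu, mul_nonneg hi hj]

/-! Regimes A'(k), B1, B2(k): the corresponding lemmas (memo §4b) are to be added by the next seat (append-only). -/

end Summit.CriticalPhenomena.PercolationContinuityZ3.Theorems.SahiE3MajAlgebra
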